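import Summits.PneNP.PneNP.Theorems.ConvexRankGatesCliqueExtLowerBoundWidthThresholdDefs
import Literature.Computability.Complexity.ExtMonotoneGates
import Literature.Computability.Complexity.MonotoneSwitching
import Mathlib

/-!
# Route ConvexRankGates, crux `CliqueExtLowerBound` (stmt-PneNP-10682): "all of `P` on" is ONE CONV gate on ONE unit CNF

Support file (`--supports stmt-PneNP-10682`, registered sub-goal `exists_convGate_unitCnf` of the line
`width-threshold-certificate-sparsity`, section `LocalityMustGrow`, lead c13). For every finite set `P` of edge
slots of `K_m`, every width `d ≥ 1` and every locality `s ≥ 2`, the monotone pattern function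
`x ↦ [∀ e ∈ P, x e = 1]` is the composition of ONE CONV gate of width `≤ d` — the unary conjunction
`∧₁ = GateFn.and 1`, a CONV gate of width `1` (`and_isConvGate 1`, then `IsConvGate.mono`) — with ONE monotone
CNF of unit clauses, `P.image ({·})` (every clause is a singleton, hence `(s-1)`-local for `s ≥ 2`), so the tuple
of children has `≤ 1` distinct member. No new definitions. [folklore]
-/

-- `Summit.PneNP.PneNP.…` duplicates `PneNP` BY DESIGN (single-problem summit).
set_option linter.dupNamespace false

open Literature.Computability.Complexity Filter Finset
open Summit.PneNP.PneNP.Theorems.CliqueExtLowerBound.WidthThreshold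

noncomputable section

namespace Summit.PneNP.PneNP.Theorems.CliqueExtLowerBound.WidthThreshold.UnitCnfConvGate

/-- The CNF of unit clauses `⋀_{e ∈ P} x_e` (clause family `{{e}}_{e ∈ P}`) holds at `x` iff every slot
of `P` is on. [folklore] -/
theorem evalCNF_image_singleton_iff {ι : Type*} [DecidableEq ι] (P : Finset ι) (x : ι → Bool) :
    EvalCNF (P.image fun e => ({e} : Finset ι)) x ↔ ∀ e ∈ P, x e = true := by
  simp [EvalCNF, SatClause]

/-- The unary conjunction `∧₁` is the identity on its single wire: `∧₁ v = v 0`. [folklore] -/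
theorem and_one_apply (v : Fin 1 → Bool) : (GateFn.and 1).2 v = v 0 := by
  rw [Bool.eq_iff_iff]
  simp [GateFn.and, Fin.forall_fin_one]

open Classical in
/-- Registered sub-goal `exists_convGate_unitCnf` (lead c13, section `LocalityMustGrow`): **the pattern
function "every edge slot of `P` is on" is ONE CONV gate of width `≤ d` (`d ≥ 1`) reading ONE CNF of unit
clauses (`s ≥ 2`)** — witness `φ = ∧₁ = GateFn.and 1` (`and_isConvGate 1 : IsConvGate 1 (GateFn.and 1)`,
then `IsConvGate.mono` from `1` to `d`) with the single child `P.image ({·})`: the tuple of children is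
constant (so `≤ 1` distinct member), every clause is a singleton (card `1 ≤ s - 1`), and
`∧₁ [EvalCNF {{e}}_{e∈P} x] = [∀ e ∈ P, x e = 1]`. [folklore] -/
theorem exists_convGate_unitCnf : ∀ (m d s : ℕ), 1 ≤ d → 2 ≤ s → ∀ P : Finset (EV m),
    ∃ (φ : GateFn) (C : Fin φ.1 → Finset (Finset (EV m))), IsConvGate d φ ∧ #(univ.image C) ≤ 1 ∧
      (∀ j, ∀ S ∈ C j, #S ≤ s - 1) ∧
      ∀ x : EV m → Bool, φ.2 (fun j => decide (EvalCNF (C j) x)) = decide (∀ e ∈ P, x e = true) := by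
  intro m d s hd hs P
  refine ⟨GateFn.and 1, fun _ => P.image fun e => ({e} : Finset (EV m)), (and_isConvGate 1).mono hd,
    card_image_le.trans_eq (Finset.card_fin 1), fun j S hS => ?_, fun x => ?_⟩
  · obtain ⟨e, -, rfl⟩ := mem_image.1 hS
    rw [card_singleton]
    omega
  · rw [and_one_apply, Bool.eq_iff_iff, decide_eq_true_iff, decide_eq_true_iff]
    exact evalCNF_image_singleton_iff P x

end Summit.PneNP.PneNP.Theorems.CliqueExtLowerBound.WidthThreshold.UnitCnfConvGate

end
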